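import Mathlib
import Summits.Ventures.PercRepro2.Defs
import Summits.Ventures.PercRepro2.Graph
import Summits.Ventures.PercRepro2.OneColourSwitch
import Summits.Ventures.PercRepro2.RegionHubSign
import Summits.Ventures.PercRepro2.SideSwitch
import Summits.Ventures.PercRepro2.TermSwitchDefs
import Summits.Ventures.PercRepro2.M9NoPocketDefs
import Summits.Ventures.PercRepro2.M9PsiOneDefs

/-!
# The second partner map `Ψ₂` of a doubly-reached colouring: definitions and the colour table
(blind cell PercRepro2, p3 g34, 2026-08-29; `proofs/P3-REST2.md` §1)

For an `EX` colouring `ω` (`Sep ∧ DOne(d)`, `d ∈ K₂ ∩ M₂`, no edge at `d` to `r, s`) with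
`σ_rs(ω) = −1` (`r ~_W s`, `r ≁_Y s`), the second partner `psiTwo ω` flips every edge touching
a `W`-block joined to `d` or a `W`-LINKING block (`r ~_W s` inside the block and `{r, s}`) that
is not an edge at `d`; the edges at `d` keep their colour — except, when there is no `W`-linking
block (the PURE case, where the `W`-link runs through `d`), the edges from `d` into the joined
`W`-vertices `W`-rooted at the root opposite to `d`'s `Y`-root, which are flipped as well (they
carry the new `Y`-link through `d`).  This file: the `W`-mirrors of the `Ψ₁` objects
(`linkingW`, `linkSetW`, `rootedW`, `flipSetW`), the root `oppRoot` of `d`, the flipped edge set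
`flippedW`, the map `psiTwo`, the block facts (the flipped set lies in the `W`-core and is closed
under `W`-core adjacency) and the colour table of `psiTwo ω` on an `EX` colouring.  The claims
of the theorem (legality, `σ_rs` reversed to `+1`, `σ_pq` not increased, injectivity) are the
successor files.  Own work; std axioms.
-/

namespace Summit.Ventures.PercRepro2

namespace NoPocket

open Finset Classical RegionHub OneColourSwitch SideSwitch TermSwitch

variable {V : Type*} {E : Type*}

section Classes

variable (ends : E → Sym2 V) (r s d : V) (ω : Config E)

/-- A `W`-core vertex is `W`-LINKING if `r ~_W s` using only the edges inside its block and
`{r, s}` (the `W`-edges of `ω` inside the block, i.e. the open edges of the colour flip). -/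
def linkingW (x : V) : Prop :=
  x ∈ Mcore ends r s d ω ∧
    Conn ends (restrictTo ends (OneColourSwitch.compl ω)
      (blockIn ends (Mcore ends r s d ω) x ∪ {r, s})) r s

/-- The `W`-linking vertices. -/
def linkSetW : Set V := {x | linkingW ends r s d ω x}

/-- A `W`-core vertex is `W`-ROOTED at the terminal `t` if it is `W`-connected to `t` using
only the edges inside its block and `{r, s}`. -/
def rootedW (t x : V) : Prop :=
  x ∈ Mcore ends r s d ω ∧
    Conn ends (restrictTo ends (OneColourSwitch.compl ω)
      (blockIn ends (Mcore ends r s d ω) x ∪ {r, s})) t x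

/-- The vertex set flipped by `Ψ₂`: the joined `W`-blocks and the `W`-linking vertices. -/
def flipSetW : Set V := joinedW ends r s d ω ∪ linkSetW ends r s d ω

/-- The PURE case: no `W`-linking vertex (the `W`-link of `r, s` runs through `d`). -/
def PureW : Prop := ∀ x, ¬ linkingW ends r s d ω x

/-- The root opposite to the `Y`-root of `d`: `s` if `d ~_Y r`, else `r`. -/
noncomputable def oppRoot : V := if Conn ends ω d r then s else r

/-- The edges flipped by `Ψ₂`: the edges touching the flipped vertex set that are not at `d`,
and — in the pure case — the edges from `d` into a joined `W`-vertex rooted at `oppRoot`. -/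
def flippedW : Set E :=
  {e | e ∈ touches ends (flipSetW ends r s d ω) ∧ d ∉ ends e} ∪
    {e | PureW ends r s d ω ∧
      ∃ y ∈ joinedW ends r s d ω, ends e = s(d, y) ∧ rootedW ends r s d ω (oppRoot ends r s d ω) y}

/-- **The second partner map `Ψ₂`**: flip the flipped edges, keep every other edge. -/
noncomputable def psiTwo : Config E :=
  fun e => if e ∈ flippedW ends r s d ω then !ω e else ω e

end Classes

section Basic

variable {ends : E → Sym2 V} {r s d : V} {ω : Config E}

/-- The colour of `Ψ₂ ω` on a flipped edge. -/
lemma psiTwo_of_flipped {e : E} (he : e ∈ flippedW ends r s d ω) :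
    psiTwo ends r s d ω e = !ω e := by
  unfold psiTwo; rw [if_pos he]

/-- The colour of `Ψ₂ ω` on a kept edge. -/
lemma psiTwo_of_not_flipped {e : E} (he : e ∉ flippedW ends r s d ω) :
    psiTwo ends r s d ω e = ω e := by
  unfold psiTwo; rw [if_neg he]

/-- The linking set lies in the `W`-core. -/
lemma linkSetW_subset_Mcore : linkSetW ends r s d ω ⊆ Mcore ends r s d ω :=
  fun _ hx => hx.1

/-- The flipped set lies in the `W`-core. -/
lemma flipSetW_subset_Mcore : flipSetW ends r s d ω ⊆ Mcore ends r s d ω := by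
  rintro x (hx | hx)
  · exact joinedW_subset_Mcore hx
  · exact hx.1

/-- The linking set is closed under edges inside the `W`-core. -/
lemma mem_linkSetW_of_edge {x y : V} {e : E} (hx : x ∈ linkSetW ends r s d ω)
    (hy : y ∈ Mcore ends r s d ω) (hends : ends e = s(x, y)) : y ∈ linkSetW ends r s d ω := by
  obtain ⟨hxM, hc⟩ := hx
  refine ⟨hy, ?_⟩
  rwa [blockIn_eq_of_conn (conn_allIn_of_edge hxM hy hends)] at hc

/-- The flipped set is closed under edges inside the `W`-core. -/
lemma mem_flipSetW_of_edge {x y : V} {e : E} (hx : x ∈ flipSetW ends r s d ω)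
    (hy : y ∈ Mcore ends r s d ω) (hends : ends e = s(x, y)) : y ∈ flipSetW ends r s d ω := by
  rcases hx with hx | hx
  · exact Or.inl (mem_joinedW_of_edge hx hy hends)
  · exact Or.inr (mem_linkSetW_of_edge hx hy hends)

/-- The flipped set is closed under edges inside the `W`-core (the other orientation). -/
lemma mem_flipSetW_of_edge' {x y : V} {e : E} (hx : x ∈ flipSetW ends r s d ω)
    (hy : y ∈ Mcore ends r s d ω) (hends : ends e = s(y, x)) : y ∈ flipSetW ends r s d ω :=
  mem_flipSetW_of_edge hx hy (by rw [hends, Sym2.eq_swap])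

/-- A rooted vertex lies in the `W`-core. -/
lemma rootedW_mem_Mcore {t x : V} (h : rootedW ends r s d ω t x) : x ∈ Mcore ends r s d ω := h.1

/-- Every `W`-core neighbour of `d` is in the flipped set. -/
lemma mem_flipSetW_of_nbr {y : V} {e : E} (hy : y ∈ Mcore ends r s d ω)
    (hends : ends e = s(d, y)) : y ∈ flipSetW ends r s d ω :=
  Or.inl (mem_joinedW_of_nbr hy hends)

/-- An edge not at `d` with an end in the flipped set is flipped. -/
lemma mem_flippedW_of_touches {x y : V} {e : E} (hx : x ∈ flipSetW ends r s d ω)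
    (hends : ends e = s(x, y)) (hxd : x ≠ d) (hyd : y ≠ d) : e ∈ flippedW ends r s d ω :=
  Or.inl ⟨⟨x, hx, y, hends⟩, notMem_of_ends_ne hends hxd hyd⟩

/-- An edge with no end in the flipped set and not at `d` is kept. -/
lemma not_mem_flippedW_of_not_touches {x y : V} {e : E} (hends : ends e = s(x, y))
    (hx : x ∉ flipSetW ends r s d ω) (hy : y ∉ flipSetW ends r s d ω) (hxd : x ≠ d)
    (hyd : y ≠ d) : e ∉ flippedW ends r s d ω := by
  rintro (⟨⟨a, ha, b, hab⟩, _⟩ | ⟨_, y', _, hy', _⟩)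
  · rw [hends, Sym2.eq_iff] at hab
    rcases hab with ⟨rfl, rfl⟩ | ⟨rfl, rfl⟩
    · exact hx ha
    · exact hy ha
  · rw [hends, Sym2.eq_iff] at hy'
    rcases hy' with ⟨h1, _⟩ | ⟨_, h2⟩
    · exact hxd h1
    · exact hyd h2

/-- An edge at `d` whose other end is not a joined `W`-vertex is kept. -/
lemma not_mem_flippedW_of_d_not_joinedW {y : V} {e : E} (hends : ends e = s(d, y))
    (hy : y ∉ joinedW ends r s d ω) : e ∉ flippedW ends r s d ω := by
  rintro (⟨_, hd⟩ | ⟨_, y', hy', hends', _⟩)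
  · exact hd (by rw [hends]; exact Sym2.mem_mk_left _ _)
  · rw [hends, Sym2.eq_iff] at hends'
    rcases hends' with ⟨_, rfl⟩ | ⟨rfl, rfl⟩
    · exact hy hy'
    · exact hy hy'

/-- An edge at `d` whose other end is `y` is kept unless `y` is a joined `W`-vertex rooted at
`oppRoot` in the pure case. -/
lemma not_mem_flippedW_of_d {y : V} {e : E} (hends : ends e = s(d, y))
    (hy : ¬ (PureW ends r s d ω ∧ y ∈ joinedW ends r s d ω ∧
      rootedW ends r s d ω (oppRoot ends r s d ω) y)) : e ∉ flippedW ends r s d ω := by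
  rintro (⟨_, hd⟩ | ⟨hp, y', hy', hends', hr⟩)
  · exact hd (by rw [hends]; exact Sym2.mem_mk_left _ _)
  · rw [hends, Sym2.eq_iff] at hends'
    rcases hends' with ⟨_, rfl⟩ | ⟨rfl, rfl⟩
    · exact hy ⟨hp, hy', hr⟩
    · exact hy ⟨hp, hy', hr⟩

/-- In the non-pure case every edge at `d` is kept. -/
lemma not_mem_flippedW_of_d_of_not_pure {y : V} {e : E} (hends : ends e = s(d, y))
    (hp : ¬ PureW ends r s d ω) : e ∉ flippedW ends r s d ω :=
  not_mem_flippedW_of_d hends (fun h => hp h.1)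

end Basic

section EX

variable {ends : E → Sym2 V} {p q r s d : V} {ω : Config E}
variable (h : IsEX ends p q r s d ω)
include h

omit h in
/-- An edge inside the flipped set is flipped (no such edge is at `d`). -/
lemma psiTwo_inside {x y : V} {e : E} (hx : x ∈ flipSetW ends r s d ω)
    (hends : ends e = s(x, y)) (hy : y ∈ Mcore ends r s d ω) :
    psiTwo ends r s d ω e = !ω e :=
  psiTwo_of_flipped (mem_flippedW_of_touches hx hends
    (flipSetW_subset_Mcore hx).2.2.2 hy.2.2.2)

omit h in
/-- An edge from the flipped set to a terminal is flipped (hence open in `Ψ₂ ω`, by (F5′)). -/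
lemma psiTwo_flip_term {x t : V} {e : E} (hx : x ∈ flipSetW ends r s d ω) (ht : t = r ∨ t = s)
    (hends : ends e = s(x, t)) (hd : d ≠ r) (hs : d ≠ s) :
    psiTwo ends r s d ω e = !ω e :=
  psiTwo_of_flipped (mem_flippedW_of_touches hx hends (flipSetW_subset_Mcore hx).2.2.2
    (by rcases ht with rfl | rfl <;> [exact hd.symm; exact hs.symm]))

/-- An edge from the flipped set to a terminal is open in `Ψ₂ ω`. -/
lemma psiTwo_flip_term_eq_true {x t : V} {e : E} (hx : x ∈ flipSetW ends r s d ω)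
    (ht : t = r ∨ t = s) (hends : ends e = s(x, t)) : psiTwo ends r s d ω e = true := by
  rw [psiTwo_flip_term hx ht hends h.hr h.hs,
    edge_Mcore_term h (flipSetW_subset_Mcore hx) ht hends]
  rfl

/-- An edge from the flipped set to the outside is closed in `Ψ₂ ω`. -/
lemma psiTwo_flip_out_eq_false {x y : V} {e : E} (hx : x ∈ flipSetW ends r s d ω)
    (hy : y ∈ Outside ends r s ω) (hends : ends e = s(x, y)) :
    psiTwo ends r s d ω e = false := by
  have hyd : y ≠ d := by
    rintro rfl
    exact hy.1 h.inK
  rw [psiTwo_of_flipped (mem_flippedW_of_touches hx hends (flipSetW_subset_Mcore hx).2.2.2 hyd),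
    edge_Mcore_out (flipSetW_subset_Mcore hx) hy hends]
  rfl

/-- An edge from the `Y`-core to anything is kept by `Ψ₂` (the `Y`-core is not adjacent to the
`W`-core, (F1)). -/
lemma psiTwo_Kcore {x y : V} {e : E} (hx : x ∈ Kcore ends r s d ω) (hends : ends e = s(x, y)) :
    psiTwo ends r s d ω e = ω e := by
  apply psiTwo_of_not_flipped
  rintro (⟨⟨a, ha, b, hab⟩, _⟩ | ⟨_, y', hy', hends', _⟩)
  · rw [hends, Sym2.eq_iff] at hab
    rcases hab with ⟨rfl, rfl⟩ | ⟨rfl, rfl⟩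
    · exact not_mem_Mcore_of_mem_Kcore h.done hx (flipSetW_subset_Mcore ha)
    · exact no_edge_core_core h hx (flipSetW_subset_Mcore ha) hends
  · rw [hends, Sym2.eq_iff] at hends'
    rcases hends' with ⟨rfl, rfl⟩ | ⟨rfl, rfl⟩
    · exact hx.2.2.2 rfl
    · exact not_mem_Mcore_of_mem_Kcore h.done hx (joinedW_subset_Mcore hy')

/-- An edge from the outside to anything outside the flipped set is kept by `Ψ₂`. -/
lemma psiTwo_out {x y : V} {e : E} (hx : x ∈ Outside ends r s ω)
    (hy : y ∉ flipSetW ends r s d ω) (hends : ends e = s(x, y)) :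
    psiTwo ends r s d ω e = ω e := by
  have hxd : x ≠ d := by
    rintro rfl
    exact hx.1 h.inK
  have hyd : y ≠ d := by
    rintro rfl
    exact no_edge_d_out h hx (by rw [hends, Sym2.eq_swap])
  exact psiTwo_of_not_flipped (not_mem_flippedW_of_not_touches hends
    (fun hx' => hx.2 (flipSetW_subset_Mcore hx').1) hy hxd hyd)

/-- An edge from a `W`-core vertex outside the flipped set is kept by `Ψ₂` (its other end is
not in the flipped set either: the flipped set is closed under `W`-core adjacency, and it is
not `d`: the `W`-core neighbours of `d` are joined). -/
lemma psiTwo_Mcore_kept {x y : V} {e : E} (hx : x ∈ Mcore ends r s d ω)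
    (hx' : x ∉ flipSetW ends r s d ω) (hends : ends e = s(x, y)) :
    psiTwo ends r s d ω e = ω e := by
  apply psiTwo_of_not_flipped
  have hxd : x ≠ d := hx.2.2.2
  have hyd : y ≠ d := by
    rintro rfl
    exact hx' (mem_flipSetW_of_nbr hx (by rw [hends, Sym2.eq_swap]))
  refine not_mem_flippedW_of_not_touches hends hx' ?_ hxd hyd
  intro hy
  exact hx' (mem_flipSetW_of_edge' hy hx hends)

/-- An edge at `d` into the `Y`-core is kept by `Ψ₂`. -/
lemma psiTwo_d_Kcore {y : V} {e : E} (hy : y ∈ Kcore ends r s d ω) (hends : ends e = s(d, y)) :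
    psiTwo ends r s d ω e = ω e :=
  psiTwo_of_not_flipped (not_mem_flippedW_of_d_not_joinedW hends
    (fun hj => not_mem_Mcore_of_mem_Kcore h.done hy (joinedW_subset_Mcore hj)))

omit h in
/-- In the non-pure case an edge at `d` is kept by `Ψ₂`. -/
lemma psiTwo_d_of_not_pure {y : V} {e : E} (hends : ends e = s(d, y))
    (hp : ¬ PureW ends r s d ω) : psiTwo ends r s d ω e = ω e :=
  psiTwo_of_not_flipped (not_mem_flippedW_of_d_of_not_pure hends hp)

omit h in
/-- An edge at `d` into a joined `W`-vertex not rooted at `oppRoot` is kept by `Ψ₂`. -/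
lemma psiTwo_d_joinedW_kept {y : V} {e : E} (hends : ends e = s(d, y))
    (hr : ¬ rootedW ends r s d ω (oppRoot ends r s d ω) y) : psiTwo ends r s d ω e = ω e :=
  psiTwo_of_not_flipped (not_mem_flippedW_of_d hends (fun h' => hr h'.2.2))

/-- In the pure case an edge at `d` into a joined `W`-vertex rooted at `oppRoot` is flipped,
hence open in `Ψ₂ ω` (the edge is closed in `ω` by (F2′)). -/
lemma psiTwo_d_opp_eq_true {y : V} {e : E} (hp : PureW ends r s d ω)
    (hy : y ∈ joinedW ends r s d ω) (hends : ends e = s(d, y))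
    (hr : rootedW ends r s d ω (oppRoot ends r s d ω) y) : psiTwo ends r s d ω e = true := by
  rw [psiTwo_of_flipped (Or.inr ⟨hp, y, hy, hends, hr⟩),
    edge_Mcore_d h (joinedW_subset_Mcore hy) (by rw [hends, Sym2.eq_swap])]
  rfl

end EX

end NoPocket

end Summit.Ventures.PercRepro2
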